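import Summits.HodgeConjecture.HodgeConjecture.Theorems.F0P2oD7alphaMemDockOfRowsT                 -- ★ p840848 (F0P2-p01 (g9)): the UNSIGNED producer `stubD7αMemDockPerMeasureT_of_rows` (fed at `Δ := Δ°` below)
import Literature.NumberTheory.GelbartRogawski1991.PiSCompletionIsThetaTypeTestSignTransport       -- B1 (F0P2-p06 (g14)): `piSCompletion_isThetaTypeAtCMTest_constMul_of_signed` (+ ★ p848284 `CharIdentityOnTestFunctionsSignTransport`, + LH10 (D-b)ᵀˢ)
import Literature.NumberTheory.Automorphic.LocalHermitianFormSign                                -- LH7-p01 (g0) Δ1: `formSignAt`, `intCast_ite_isUnitNorm_eq_formSignAt_of_formCongr_eq_smul`, `formSignAt_eq_one_or_eq_neg_one`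
import Literature.NumberTheory.Automorphic.LocalUnitaryGroupCongrInner                            -- ★ `conjLocal_eq_self_of_formCongr_eq_smul_antidiag` (the frame multiplier is `σ`-fixed)
import HarnessLib

/-!
# Crux `H413`, programme P2 — (D7α-J) PRODUCER, TEST EDITION, **SIGNED ROWS**: the node `StubD7αMemDockPerMeasureT` from record data SIGNED at the factor of record `Δ‴`
# (organ B2 «ADAPTER, SIGNED ROWS» of F0P2-ref1 (g10) objection ⑧ r353; LEAD F0P3a-plan (g13) T12-14 (3): «D7αᵀ ⟸ `stubD7αMemDockPerMeasureT_of_rowsSigned` ∘ closer rows, `Δ := Δ°` inside the node's ∃»)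

Cell `hodgecm-mathlib` (D-0151), FLOOR 0, crux item H413 = `stmt-HodgeConjecture-24833`, route of record `HCCMUnconditional`; programme P2, fallback road PKΠ
`Cruxes/H413/Lines/F0_P2PKPiRung4.lean`, Day-X recipe of record (amended T12-14 (3)).  Seat F0P2-p06 (g14).  Helper file: THEOREMS ONLY (no definition, no named fact, no
instance declaration or attribute, no notation, no `sorry`); `--supports stmt-HodgeConjecture-24833`; Lines-free.  HONEST LABEL: HC_CM is proved only modulo the printed
citations (2 remaining named inputs hLiu418 24832, h413 24833) until rung 0 closes; this file discharges none of them — it is the SIGN ADAPTER between the closer's SIGNED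
exports at the tree's transfer factor of record and the UNSIGNED producer ★ `F0P2oD7alphaMemDockOfRowsT.stubD7αMemDockPerMeasureT_of_rows`.

WHY (F0P2-ref1 r353 (A)(B), kernel probe r354 (2)).  ★ `…OfRowsT` binds, at ONE ∃-bound family `Δ`, the UNSIGNED (H₄ᵀ) SHAPE identity (13.1.4) and the UNSIGNED print letter
(H₈ᵀ) ★ `piSCompletion_isThetaTypeAtCMTest`.  The closer's rung-0 record carries the character identities SIGNED at `Δ‴_v` (RULING «K»: `χ_ξ(f^H) = ε_v(H)·Σ χ_π(f)` for
`Δ‴_v`-matched test pairs, `ε_v(H) = ω_{L_w∕L⁺_v}(a) = ω_{L_w∕L⁺_v}(−det H)` the class of the frame multiplier; ★ `CMCharIdentityClausesTestSigned`, LH10's (D-b)ᵀˢ ★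
`piSCompletion_isThetaTypeAtCMTestSigned`), and at `Δ := Δ‴` the unsigned binders are REFUTABLE whenever `ε_v(H) = −1` (linear independence of characters).  The repair is to
feed the unsigned producer at PRINT's factor `Δ° := fun v => (Δ‴ v).constMul (ε v)` with `ε v := formSignAt L c H v` (LH7 Δ1; frame-independent since `a ≡ −det H` modulo
norms): by B1 ★ `CharIdentityOnTestFunctionsSignTransport` a pair `(f^H, f)` is `Δ°_v`-matched iff `(ε_v f^H, f)` is `Δ‴_v`-matched, so (H₄ᵀ) at `Δ°` ⟸ the SIGNED SHAPE at `Δ‴`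
(★ `LocalAPacket.charIdentityAtTest_constMul_iff`), (H₇) at `Δ°` ⟸ (H₇) at `Δ‴` (★ `isLocalDeltaTransferExists_constMul_iff`, `ε_v ≠ 0`), (H₈ᵀ) at `Δ°` ⟸ (D-b)ᵀˢ at `Δ‴`
(★ `piSCompletion_isThetaTypeAtCMTest_constMul_of_signed`); Haar data and the MEM rows are sign-free.  The sign facts consumed are LH7's
`intCast_ite_isUnitNorm_eq_formSignAt_of_formCongr_eq_smul` (with the multiplier's `σ`-fixedness ★ `conjLocal_eq_self_of_formCongr_eq_smul_antidiag` and one place above a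
non-split `v` ★ `PlacesOver.subsingleton_of_smul_eq`) and `formSignAt_eq_one_or_eq_neg_one`.

* **`stubD7αMemDockPerMeasureT_of_rowsSigned`** — hypotheses H₁ `𝔇`, H₂ `h` (the fourteen rows) VERBATIM as in ★ `…_of_rows`, and ONE bundled `hrecS` per frame ∕ measure over record
  data `(Δ, mH, mG, νG, νH, μZ)` = ★ `…_of_rows`'s `hrecT` TEXT with exactly two changes: the SHAPE identity's member traces are `fun c f => ε_v(a) · tr c(f dν_G)` with
  `ε_v(a) := if ∃ z, IsUnit z ∧ a = z·σz then 1 else −1` at the SHAPE's own frame `(Tv, a)` (the token of ★ `CMNonsplitCharIdentityAtTestSigned` ∕ (D-b)ᵀˢ), and (H₈ᵀ) is the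
  SIGNED letter ★ `GelbartRogawski1991.piSCompletion_isThetaTypeAtCMTestSigned` BY NAME; conclusion the node of record ★ `F0P2oD7alphaMemDockStatement.StubD7αMemDockPerMeasureT`
  BY NAME (unchanged).
[cite: Rogawski1990, §13.1 Prop. 13.1.3 (d), Prop. 13.1.4 p. 199; §4.9 Prop. 4.9.1 (a) p. 55; §14.6 p. 242] [cite: GelbartRogawski1991, Lem. 5.1.2 p. 466; Thm. 5.1.1 p. 465]
[cite: LanglandsShelstad1987, §1]
-/

set_option autoImplicit false
-- the mandated namespace repeats `HodgeConjecture.HodgeConjecture`, as in every `Theorems/*.lean` of this sub-problem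
set_option linter.dupNamespace false

noncomputable section

open NumberField IsDedekindDomain MeasureTheory
open scoped Matrix ComplexOrder

namespace Summit.HodgeConjecture.HodgeConjecture.Cruxes.H413.F0P2oD7alphaMemDockOfRowsSigned

open Literature.NumberTheory.Rogawski1990 Literature.NumberTheory.GaloisRepresentations
open Literature.NumberTheory.Automorphic Literature.NumberTheory.Automorphic.UnitaryGroup
open Literature.NumberTheory.Automorphic.UnitaryGroup.CotangentForms
open Literature.RepresentationTheory.BorelWallach2000 Literature.RepresentationTheory.KonnoKonno2007
open Summit.HodgeConjecture.HodgeConjecture.Cruxes.H413.F0P3InnerFormClassificationV6 (Gp Places)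
open Summit.HodgeConjecture.HodgeConjecture.Cruxes.H413.F0P3KitOfRecord (FrameData kitFamilyOfRecord)
open Summit.HodgeConjecture.HodgeConjecture.Cruxes.H413.F0P3XiArchPacketOfRecord (JInfNoDegOne DsInfNoDegOne)

/-! ## §1 THE PACKET-LEVEL TEST NODE `StubD7αMemDockPerMeasureT` FROM THE ROWS AND RECORD DATA SIGNED AT THE FACTOR OF RECORD -/

section PerMeasureS

variable
  (𝔇 : ∀ (L : Type) [Field L] [NumberField L] [IsCMField L] (ι : L →+* ℂ) (H : Matrix (Fin 3) (Fin 3) L) (T : GL (Fin 3) ℂ)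
    (hT : (T : Matrix (Fin 3) (Fin 3) ℂ)ᴴ * H.map ι * (T : Matrix (Fin 3) (Fin 3) ℂ) = Literature.Geometry.ComplexHyperbolic.BallModel.J),
    (∀ τ' : L →+* ℂ, InfinitePlace.mk τ' ≠ InfinitePlace.mk ι → (H.map τ').PosDef) →
    2 ≤ Module.finrank ℚ ↥(maximalRealSubfield L) →
    ∀ (μ : Measure (Gp L H).automorphicQuotient) [(Gp L H).IsAutomorphicMeasure μ] (μω : HeckeCharacter L) (_hμu : μω.IsUnitary),
    (∀ x : Literature.NumberTheory.GaloisRepresentations.ideleGroup ↥(maximalRealSubfield L),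
      μω (AdeleRing.ideleBaseChange (↥(maximalRealSubfield L)) L x) = quadraticHeckeCharCM L x) → FrameData L H ι T hT μ)
  (h : ∀ (L : Type) [Field L] [NumberField L] [IsCMField L] (ι : L →+* ℂ) (H : Matrix (Fin 3) (Fin 3) L) (T : GL (Fin 3) ℂ)
    (hT : (T : Matrix (Fin 3) (Fin 3) ℂ)ᴴ * H.map ι * (T : Matrix (Fin 3) (Fin 3) ℂ) = Literature.Geometry.ComplexHyperbolic.BallModel.J)
    (hdef : ∀ τ' : L →+* ℂ, InfinitePlace.mk τ' ≠ InfinitePlace.mk ι → (H.map τ').PosDef) (h2 : 2 ≤ Module.finrank ℚ ↥(maximalRealSubfield L))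
    (μ : Measure (Gp L H).automorphicQuotient) [(Gp L H).IsAutomorphicMeasure μ] (μω : HeckeCharacter L) (hμu : μω.IsUnitary)
    (hμω : ∀ x : Literature.NumberTheory.GaloisRepresentations.ideleGroup ↥(maximalRealSubfield L),
      μω (AdeleRing.ideleBaseChange (↥(maximalRealSubfield L)) L x) = quadraticHeckeCharCM L x),
    ∃ S₀ : Finset (Places L),
    F0P3InnerFormClassificationV8.ClassificationKit.SpecPkg (kitFamilyOfRecord 𝔇 L ι H T hT hdef h2 μ μω hμu hμω) S₀ ∧
    (kitFamilyOfRecord 𝔇 L ι H T hT hdef h2 μ μω hμu hμω).TraceIdentity ∧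
    F0P3InnerFormClassificationV8.ClassificationKit.FactorisationCls (kitFamilyOfRecord 𝔇 L ι H T hT hdef h2 μ μω hμu hμω) S₀ ∧
    (kitFamilyOfRecord 𝔇 L ι H T hT hdef h2 μ μω hμu hμω).SpectralSideGp ∧
    F0P3InnerFormClassificationV8.ClassificationKit.HatBounded (kitFamilyOfRecord 𝔇 L ι H T hT hdef h2 μ μω hμu hμω) S₀ ∧
    F0P3InnerFormClassificationV8.ClassificationKit.UnrStarAlgebra (kitFamilyOfRecord 𝔇 L ι H T hT hdef h2 μ μω hμu hμω) S₀ ∧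
    (kitFamilyOfRecord 𝔇 L ι H T hT hdef h2 μ μω hμu hμω).LinIndepS ∧
    F0P3InnerFormClassificationV8.ClassificationKit.UnitaryPacket (kitFamilyOfRecord 𝔇 L ι H T hT hdef h2 μ μω hμu hμω) S₀ ∧
    (kitFamilyOfRecord 𝔇 L ι H T hT hdef h2 μ μω hμu hμω).Routing ∧
    JInfNoDegOne (𝔇 L ι H T hT hdef h2 μ μω hμu hμω).jInf ∧ DsInfNoDegOne (𝔇 L ι H T hT hdef h2 μ μω hμu hμω).dsInf ∧
    (kitFamilyOfRecord 𝔇 L ι H T hT hdef h2 μ μω hμu hμω).XiFamilyFin μω hμu ∧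
    (kitFamilyOfRecord 𝔇 L ι H T hT hdef h2 μ μω hμu hμω).XiUnram ∧
    (kitFamilyOfRecord 𝔇 L ι H T hT hdef h2 μ μω hμu hμω).EvpConvention)

include h in
open scoped Classical in
/-- **`StubD7αMemDockPerMeasureT` FROM THE ROWS AND RECORD DATA SIGNED AT THE FACTOR OF RECORD (assembly + the B1 sign transport).**  Hypotheses H₁ `𝔇`, H₂ `h` (the
fourteen rows) as in ★ `F0P2oD7alphaMemDockOfRowsT.stubD7αMemDockPerMeasureT_of_rows`, and — bundled per frame AND per measure into ONE hypothesis `hrecS` over record data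
`(Δ, mH, mG, νG, νH, μZ)`, `Δ` intended to be the tree's factor of record `Δ‴` — (H₄ᵀˢ) the SHAPE of the kit family's finite packets at non-split places
(`packFin ξ v = ⟨πⁿ ∘ e, some πˢ⟩`, Keys labels, `πˢ` supercuspidal `≠ πⁿ ∘ e`) with the identity (13.1.4) ON TEST FUNCTIONS **SIGNED** by the clause sign
`ε_v(a) = (if ∃ z, IsUnit z ∧ a = z·σz then 1 else −1)` of the SHAPE's frame multiplier `a` (member traces `f ↦ ε_v(a)·tr c(f dν_G)`; the token of ★
`CMNonsplitCharIdentityAtTestSigned` ∕ ★ `piSCompletion_isThetaTypeAtCMTestSigned`), (H₅)(H₆) Haar `μZ v`, `νG v`, (H₇) test-function transfer existence at `Δ`, (H₈ᵀˢ) the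
SIGNED print letter (D-b)ᵀˢ ★ `GelbartRogawski1991.piSCompletion_isThetaTypeAtCMTestSigned` BY NAME at `Δ`.  Conclusion: the node of record ★
`F0P2oD7alphaMemDockStatement.StubD7αMemDockPerMeasureT` BY NAME (unchanged).  Proof: ★ `…_of_rows` at print's factor `Δ° := fun v => (Δ v).constMul ↑(formSignAt L c H v)`; the
three `Δ`-dependent record hypotheses are transported from `Δ` to `Δ°` by B1 (★ `LocalAPacket.charIdentityAtTest_constMul_iff`, ★ `isLocalDeltaTransferExists_constMul_iff`,
★ `piSCompletion_isThetaTypeAtCMTest_constMul_of_signed`) along LH7's bridge `ε_v(a) = formSignAt L c H v` (`intCast_ite_isUnitNorm_eq_formSignAt_of_formCongr_eq_smul`).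
[cite: Rogawski1990, §13.1 Prop. 13.1.3 (d), Prop. 13.1.4 p. 199; §4.9 Prop. 4.9.1 (a) p. 55; §14.6 p. 242] [cite: GelbartRogawski1991, Lem. 5.1.2 p. 466; Thm. 5.1.1 p. 465]
[cite: LanglandsShelstad1987, §1] -/
theorem stubD7αMemDockPerMeasureT_of_rowsSigned
  (hrecS : ∀ (L : Type) [Field L] [NumberField L] [IsCMField L] (ι : L →+* ℂ) (H : Matrix (Fin 3) (Fin 3) L) (T : GL (Fin 3) ℂ)
    (hT : (T : Matrix (Fin 3) (Fin 3) ℂ)ᴴ * H.map ι * (T : Matrix (Fin 3) (Fin 3) ℂ) = Literature.Geometry.ComplexHyperbolic.BallModel.J)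
    (hdef : ∀ τ' : L →+* ℂ, InfinitePlace.mk τ' ≠ InfinitePlace.mk ι → (H.map τ').PosDef) (h2 : 2 ≤ Module.finrank ℚ ↥(maximalRealSubfield L))
    (μω : HeckeCharacter L) (hμu : μω.IsUnitary)
    (hμω : ∀ x : Literature.NumberTheory.GaloisRepresentations.ideleGroup ↥(maximalRealSubfield L), μω (AdeleRing.ideleBaseChange (↥(maximalRealSubfield L)) L x) = quadraticHeckeCharCM L x)
    (μ : Measure (adelicGroupData (↥(maximalRealSubfield L)) L (IsCMField.complexConj L) 3 H).automorphicQuotient) [(adelicGroupData (↥(maximalRealSubfield L)) L (IsCMField.complexConj L) 3 H).IsAutomorphicMeasure μ],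
    letI : ∀ v : HeightOneSpectrum (𝓞 ↥(maximalRealSubfield L)), MeasurableSpace ((cmDatum L 3 H).Local v) := fun _ => borel _
    letI : ∀ v : HeightOneSpectrum (𝓞 ↥(maximalRealSubfield L)),
        MeasurableSpace ((cmDatum L 2 (Matrix.of fun i j : Fin 2 => if i.val + j.val + 1 = 2 then (1 : L) else 0)).Local v ×
          (cmDatum L 1 (Matrix.of fun i j : Fin 1 => if i.val + j.val + 1 = 1 then (1 : L) else 0)).Local v) := fun _ => borel _
    letI : ∀ (v : HeightOneSpectrum (𝓞 ↥(maximalRealSubfield L)))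
        (a : ((cmDatum L 2 (Matrix.of fun i j : Fin 2 => if i.val + j.val + 1 = 2 then (1 : L) else 0)).Local v ×
          (cmDatum L 1 (Matrix.of fun i j : Fin 1 => if i.val + j.val + 1 = 1 then (1 : L) else 0)).Local v)),
        MeasurableSpace (((cmDatum L 2 (Matrix.of fun i j : Fin 2 => if i.val + j.val + 1 = 2 then (1 : L) else 0)).Local v ×
            (cmDatum L 1 (Matrix.of fun i j : Fin 1 => if i.val + j.val + 1 = 1 then (1 : L) else 0)).Local v) ⧸
          Subgroup.centralizer ({a} : Set ((cmDatum L 2 (Matrix.of fun i j : Fin 2 => if i.val + j.val + 1 = 2 then (1 : L) else 0)).Local v ×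
            (cmDatum L 1 (Matrix.of fun i j : Fin 1 => if i.val + j.val + 1 = 1 then (1 : L) else 0)).Local v))) := fun _ _ => borel _
    letI : ∀ (v : HeightOneSpectrum (𝓞 ↥(maximalRealSubfield L))) (γ : (cmDatum L 3 H).Local v),
        MeasurableSpace ((cmDatum L 3 H).Local v ⧸ Subgroup.centralizer ({γ} : Set ((cmDatum L 3 H).Local v))) := fun _ _ => borel _
    letI : ∀ v : HeightOneSpectrum (𝓞 ↥(maximalRealSubfield L)), MeasurableSpace (Gqs L v ⧸ Subgroup.center (Gqs L v)) := fun _ => borel _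
    ∃ (Δ : ∀ v : HeightOneSpectrum (𝓞 ↥(maximalRealSubfield L)), LocalTransferFactor L H v)
      (mH : ∀ v : HeightOneSpectrum (𝓞 ↥(maximalRealSubfield L)),
    OrbitalMeasureFamily ((cmDatum L 2 (Matrix.of fun i j : Fin 2 => if i.val + j.val + 1 = 2 then (1 : L) else 0)).Local v ×
      (cmDatum L 1 (Matrix.of fun i j : Fin 1 => if i.val + j.val + 1 = 1 then (1 : L) else 0)).Local v))
      (mG : ∀ v : HeightOneSpectrum (𝓞 ↥(maximalRealSubfield L)), OrbitalMeasureFamily ((cmDatum L 3 H).Local v))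
      (νG : ∀ v : HeightOneSpectrum (𝓞 ↥(maximalRealSubfield L)), Measure ((cmDatum L 3 H).Local v))
      (νH : ∀ v : HeightOneSpectrum (𝓞 ↥(maximalRealSubfield L)),
    Measure ((cmDatum L 2 (Matrix.of fun i j : Fin 2 => if i.val + j.val + 1 = 2 then (1 : L) else 0)).Local v ×
      (cmDatum L 1 (Matrix.of fun i j : Fin 1 => if i.val + j.val + 1 = 1 then (1 : L) else 0)).Local v))
      (μZ : ∀ v : HeightOneSpectrum (𝓞 ↥(maximalRealSubfield L)), Measure (Gqs L v ⧸ Subgroup.center (Gqs L v))),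
      -- (H₄ᵀˢ) SHAPE of the kit family's finite packets at non-split places, the identity (13.1.4) for `⟨πⁿ ∘ e, some πˢ⟩` ON TEST FUNCTIONS **SIGNED** by the clause sign
      -- `ε_v(a)` of the SHAPE's own frame multiplier `a` (the node's local form-congruence binder `T` is spelled `Tv` here, the frame's `T : GL (Fin 3) ℂ` being in scope)
      (∀ (ξ : OneDimAutRepH L) (v : HeightOneSpectrum (𝓞 ↥(maximalRealSubfield L))),
          (∀ w : PlacesOver L v, IsCMField.complexConj L • w.1 = w.1) →
          ∃ (Tv : GL (Fin 3) (LocalRing L v)) (a : LocalRing L v) (ha : IsUnit a)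
            (h : formCongr (conjLocal L (IsCMField.complexConj L) v) Tv (H.map (algebraMap L (LocalRing L v))) =
              a • (Matrix.of fun i j : Fin 3 => if i.val + j.val + 1 = 3 then (1 : L) else 0).map (algebraMap L (LocalRing L v)))
            (π2 πn : IrrClass (Gqs L v)) (πs : IrrClass ((cmDatum L 3 H).Local v)),
            KeysCaseTwoLabels L v (μω.semilocalComponent L v) (torusLocalComponent L (IsCMField.complexConj L) v ξ.η)
                (torusLocalComponent L (IsCMField.complexConj L) v ξ.ψ) π2 πn ∧
              π2.IsSquareIntegrable (μZ v) ∧ ¬ πn.IsSquareIntegrable (μZ v) ∧ πs.IsSupercuspidal ∧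
              πs ≠ IrrClass.comap (cmDatumLocalCongr L v Tv ha h).symm πn ∧
              (⟨IrrClass.comap (cmDatumLocalCongr L v Tv ha h).symm πn, some πs⟩ : CMLocalAPacket L H v).CharIdentityAtTest L H v
                (fun c f => (if ∃ z : LocalRing L v, IsUnit z ∧ a = z * conjLocal L (IsCMField.complexConj L) v z then (1 : ℂ) else -1) * c.smoothTrace (νG v) f)
                (ξ.xiLocalChar v) (νH v) (Δ v) (mH v) (mG v) ∧
              (kitFamilyOfRecord 𝔇 L ι H T hT hdef h2 μ μω hμu hμω).packFin ξ v = ⟨IrrClass.comap (cmDatumLocalCongr L v Tv ha h).symm πn, some πs⟩) ∧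
      -- (H₅) (H₆) Haar measures: `μZ v` and `νG v`
      (∀ v : HeightOneSpectrum (𝓞 ↥(maximalRealSubfield L)), (μZ v).IsHaarMeasure) ∧
      (∀ v : HeightOneSpectrum (𝓞 ↥(maximalRealSubfield L)), (νG v).IsHaarMeasure) ∧
      -- (H₇) `φ ↦ φ^H` exists on `C_c^∞` at every non-split finite place [Rogawski1990 Prop. 4.9.1 (a)], at `Δ`
      (∀ v : HeightOneSpectrum (𝓞 ↥(maximalRealSubfield L)), (∀ w : PlacesOver L v, IsCMField.complexConj L • w.1 = w.1) →
        IsLocalDeltaTransferExists L H v (Δ v) (mH v) (mG v) Literature.NumberTheory.Rogawski1990.IsLocSmooth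
          Literature.NumberTheory.Rogawski1990.IsLocSmooth) ∧
      -- (H₈ᵀˢ) the SIGNED print letter (D-b)ᵀˢ ON TEST FUNCTIONS, BY NAME, at these data [GelbartRogawski1991 Lem. 5.1.2, Thm. 5.1.1; Rogawski1992 Thm. 1.1]
      (∀ {n' : ℕ} (e₁ : Fin 3 × Fin 1 ≃ Fin n') (dV : Fin 3 → L) (hdV : ∀ i, IsCMField.complexConj L (dV i) = dV i) (hdV0 : ∀ i, dV i ≠ 0) (g : GL (Fin 3) L)
          (hg : ((g : Matrix (Fin 3) (Fin 3) L).map (cmConjRingHom L))ᵀ * H * (g : Matrix (Fin 3) (Fin 3) L) = Matrix.diagonal dV) (ξ : OneDimAutRepH L),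
        Literature.NumberTheory.GelbartRogawski1991.piSCompletion_isThetaTypeAtCMTestSigned L H Δ mH mG νH νG ξ μω (fun v => ξ.xiLocalChar v) e₁ dV hdV hdV0 g hg)) :
    F0P2oD7alphaMemDockStatement.StubD7αMemDockPerMeasureT := by
  refine F0P2oD7alphaMemDockOfRowsT.stubD7αMemDockPerMeasureT_of_rows 𝔇 h fun L _ _ _ ι H T hT hdef h2 μω hμu hμω μ _ => ?_
  -- borel σ-algebras, as in the node's ∕ the producer's `letI`s
  letI : ∀ v : HeightOneSpectrum (𝓞 ↥(maximalRealSubfield L)), MeasurableSpace ((cmDatum L 3 H).Local v) := fun _ => borel _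
  letI : ∀ v : HeightOneSpectrum (𝓞 ↥(maximalRealSubfield L)),
      MeasurableSpace ((cmDatum L 2 (Matrix.of fun i j : Fin 2 => if i.val + j.val + 1 = 2 then (1 : L) else 0)).Local v ×
        (cmDatum L 1 (Matrix.of fun i j : Fin 1 => if i.val + j.val + 1 = 1 then (1 : L) else 0)).Local v) := fun _ => borel _
  letI : ∀ (v : HeightOneSpectrum (𝓞 ↥(maximalRealSubfield L)))
      (a : ((cmDatum L 2 (Matrix.of fun i j : Fin 2 => if i.val + j.val + 1 = 2 then (1 : L) else 0)).Local v ×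
        (cmDatum L 1 (Matrix.of fun i j : Fin 1 => if i.val + j.val + 1 = 1 then (1 : L) else 0)).Local v)),
      MeasurableSpace (((cmDatum L 2 (Matrix.of fun i j : Fin 2 => if i.val + j.val + 1 = 2 then (1 : L) else 0)).Local v ×
          (cmDatum L 1 (Matrix.of fun i j : Fin 1 => if i.val + j.val + 1 = 1 then (1 : L) else 0)).Local v) ⧸
        Subgroup.centralizer ({a} : Set ((cmDatum L 2 (Matrix.of fun i j : Fin 2 => if i.val + j.val + 1 = 2 then (1 : L) else 0)).Local v ×
          (cmDatum L 1 (Matrix.of fun i j : Fin 1 => if i.val + j.val + 1 = 1 then (1 : L) else 0)).Local v))) := fun _ _ => borel _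
  letI : ∀ (v : HeightOneSpectrum (𝓞 ↥(maximalRealSubfield L))) (γ : (cmDatum L 3 H).Local v),
      MeasurableSpace ((cmDatum L 3 H).Local v ⧸ Subgroup.centralizer ({γ} : Set ((cmDatum L 3 H).Local v))) := fun _ _ => borel _
  letI : ∀ v : HeightOneSpectrum (𝓞 ↥(maximalRealSubfield L)), MeasurableSpace (Gqs L v ⧸ Subgroup.center (Gqs L v)) := fun _ => borel _
  obtain ⟨Δ, mH, mG, νG, νH, μZ, hshape, hHaar, hνG, hex, hW⟩ := hrecS L ι H T hT hdef h2 μω hμu hμω μ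
  -- the frame's `H` is hermitian; the sign family `ε v := formSignAt L c H v` (LH7 Δ1) read in `ℂ`
  have hH : (H.map (cmConjRingHom L))ᵀ = H := transpose_map_cmConjRingHom_eq_of_frame L ι H T hT
  have hεn : ∀ v : HeightOneSpectrum (𝓞 ↥(maximalRealSubfield L)), (∀ w : PlacesOver L v, IsCMField.complexConj L • w.1 = w.1) →
      ∀ (Tv : GL (Fin 3) (LocalRing L v)) (a : LocalRing L v), IsUnit a →
        formCongr (conjLocal L (IsCMField.complexConj L) v) Tv (H.map (algebraMap L (LocalRing L v))) =
          a • (Matrix.of fun i j : Fin 3 => if i.val + j.val + 1 = 3 then (1 : L) else 0).map (algebraMap L (LocalRing L v)) →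
        (if ∃ z : LocalRing L v, IsUnit z ∧ a = z * conjLocal L (IsCMField.complexConj L) v z then (1 : ℂ) else -1) =
          ((formSignAt L (IsCMField.complexConj L) H v : ℤ) : ℂ) := by
    intro v hns Tv a ha h'
    obtain ⟨w⟩ := (inferInstance : Nonempty (PlacesOver L v))
    have hv : Subsingleton (PlacesOver L v) :=
      PlacesOver.subsingleton_of_smul_eq (IsCMField.complexConj L) (IsCMField.complexConj_ne_one L) w (hns w)
    have hσa : conjLocal L (IsCMField.complexConj L) v a = a :=
      conjLocal_eq_self_of_formCongr_eq_smul_antidiag L (by norm_num) hH v Tv h'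
    exact intCast_ite_isUnitNorm_eq_formSignAt_of_formCongr_eq_smul L (IsCMField.complexConj L) H v hv ha hσa h'
  have hε0 : ∀ v : HeightOneSpectrum (𝓞 ↥(maximalRealSubfield L)), ((formSignAt L (IsCMField.complexConj L) H v : ℤ) : ℂ) ≠ 0 := by
    intro v
    rcases formSignAt_eq_one_or_eq_neg_one L (IsCMField.complexConj L) H v with h1 | h1 <;> rw [h1] <;> norm_num
  refine ⟨fun v => (Δ v).constMul ((formSignAt L (IsCMField.complexConj L) H v : ℤ) : ℂ), mH, mG, νG, νH, μZ, ?_, hHaar, hνG, ?_, ?_⟩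
  · -- (H₄ᵀ) at `Δ°` from the SIGNED SHAPE at `Δ` (B1 `charIdentityAtTest_constMul_iff` along LH7's bridge at the SHAPE's own frame)
    intro ξ v hns
    obtain ⟨Tv, a, ha, h', π2, πn, πs, hK, h2sq, hnsq, hsc, hne, hCI, hpack⟩ := hshape ξ v hns
    refine ⟨Tv, a, ha, h', π2, πn, πs, hK, h2sq, hnsq, hsc, hne, ?_, hpack⟩
    have hsign : (if ∃ z : LocalRing L v, IsUnit z ∧ a = z * conjLocal L (IsCMField.complexConj L) v z then (1 : ℂ) else -1) *
        (if ∃ z : LocalRing L v, IsUnit z ∧ a = z * conjLocal L (IsCMField.complexConj L) v z then (1 : ℂ) else -1) = 1 := by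
      split_ifs <;> norm_num
    dsimp only
    rw [← hεn v hns Tv a ha h']
    exact (LocalAPacket.charIdentityAtTest_constMul_iff L H v _ (fun c f => c.smoothTrace (νG v) f) (ξ.xiLocalChar v) (νH v)
      (Δ v) (mH v) (mG v) hsign).2 hCI
  · -- (H₇) at `Δ°` from (H₇) at `Δ` (B1 `isLocalDeltaTransferExists_constMul_iff`, `ε_v ≠ 0`)
    intro v hns
    exact (isLocalDeltaTransferExists_constMul_iff L H v (Δ v) (mH v) (mG v) (hε0 v)).2 (hex v hns)
  · -- (H₈ᵀ) at `Δ°` from (D-b)ᵀˢ at `Δ` (B1 (D-b) corollary)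
    intro n' e₁ dV hdV hdV0 g hg ξ
    exact Literature.NumberTheory.GelbartRogawski1991.piSCompletion_isThetaTypeAtCMTest_constMul_of_signed L H Δ mH mG νH νG ξ μω
      (fun v => ξ.xiLocalChar v) e₁ dV hdV hdV0 g hg (fun v => ((formSignAt L (IsCMField.complexConj L) H v : ℤ) : ℂ)) hεn (hW e₁ dV hdV hdV0 g hg ξ)

end PerMeasureS

end Summit.HodgeConjecture.HodgeConjecture.Cruxes.H413.F0P2oD7alphaMemDockOfRowsSigned

end
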